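import Literature.AnabelianGeometry.SemiGraphs.Remark2101Reduction
import Literature.AnabelianGeometry.SemiGraphs.SurfaceTypeEdgeSeparation
import Literature.AnabelianGeometry.SemiGraphs.SurfaceTypeCoverings
import Literature.AnabelianGeometry.SemiGraphs.BranchActionKernelTransport
import Literature.AnabelianGeometry.SemiGraphs.LevelEdgesLoops
import Literature.AnabelianGeometry.SemiGraphs.LevelEdgesStabilizers
import Literature.AnabelianGeometry.SemiGraphs.FiniteEtaleCoveringDictionaryProofs
import Literature.AnabelianGeometry.SemiGraphs.FiniteEtaleCoveringConnectedProofs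
import Literature.AnabelianGeometry.SemiGraphs.FiniteEtaleCoveringGlobalHolds
import Literature.AnabelianGeometry.SemiGraphs.CoveringOfObjectProofs
import Literature.AnabelianGeometry.SemiGraphs.CoverticialVertexCaseTools
import Literature.AnabelianGeometry.Anabelioids.ConnectedOfTransitive
import Literature.AnabelianGeometry.SemiGraphs.LevelBranchGroupsDictionary
import Literature.GroupTheory.CombinatorialGroupTheory.PuncturedSurfaceGroupFiniteIndexSubgroupHolds

/-!
# [SemiAnbd] Remark 2.10.1: edge groups of a semi-graph of anabelioids of surface type are
# commensurably terminal — the proof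

Mochizuki, *Semi-graphs of anabelioids*, Publ. RIMS **42** (2006), Remark 2.10.1 p. 32: "In the case
of Example 2.10, it is not difficult to show, using exactly the same techniques as those used in the
proofs of Proposition 2.6, Corollary 2.7, that `C_{Π_𝒢}(Π_b) = Π_b`" … "we leave the task of working out
the routine details to the interested reader" [cite: MochizukiSemiAnbd2006, Rem. 2.10.1 p.32].  Cell abc-iut, layer L3, row F-1477
(`remark_2_10_1`, `Coverticial.lean`), seat abc-iut-L3-t12 (holder/assembler of the sub-DAG
`plan/L3/SUBDAG-SemiAnbd-Rmk2101.md`).  Proof-only.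

THE ARGUMENT (level-wise edge separation `LevelEdgeSeparation`, `Remark2101Reduction.lean`, which
already yields `remark_2_10_1` by the profinite closing argument `remark_2_10_1_of_levelEdgeSeparation`).
Fix `𝒢` of surface type and connected, a branch `b ∈ e` at `v`, basepoints, `A := Im(Π_b → Π_𝒢)`, an
open normal `V ⊆ Π_𝒢` and `g` with `V ∩ A ⊆ g A g⁻¹`; suppose `g ∉ V·A`.
* (L1) `X := A_V ∈ B(𝒢)`, the Galois object all of whose points have stabiliser `V`
  (`exists_bObj_stabilizer_eq`), connected (`isConnected_of_stabilizer_eq_of_card`, abc-iut-L6-t18).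
* (L2)/(L3) The finite étale covering `𝒢_X → 𝒢` (`BObj.coveringGraph`, `coveringHom`, abc-iut-L3-t5) is
  connected (D8) and OF SURFACE TYPE (`IsOfSurfaceType.of_isFiniteEtaleCoveringGlobal`, abc-iut-w4-d089,
  granted the classical fact `PuncturedSurfaceGroupFiniteIndexSubgroup`, PROVED in the tree as
  `puncturedSurfaceGroupFiniteIndexSubgroup_holds` — fed in at the end: `levelEdgeSeparation_holds`,
  `remark_2_10_1_holds` are UNCONDITIONAL).
* (L4) Level edges (abc-iut-L6-t18 `LevelEdgesOfObject` / `LevelEdgesLoops` / `LevelEdgesStabilizers`):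
  the level edges `(e, Q₁) ∋ y(x_D)` and `(e, Q₂) ∋ y(g⁻¹ · x_D)` are distinct since `g ∉ V·A`
  (`eComp_eq_iff_mem_mul_of_inv`); the loop hypothesis of the separation theorem holds for them
  (`coveringGraph_hloop`); the dictionary (abc-iut-w5-d186 `BObj.coveringHom_levelBranch_dictionary`,
  with the tautological base point `x_D` of abc-iut-L6-d4's `CoveringOfObjectVertexAligned`) locates
  the images in `Π_𝒢` of the two level-branch groups as `V ∩ γᵢ A γᵢ⁻¹` with `(e, Qᵢ) ∋ y(γᵢ⁻¹ · x_D)`,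
  i.e. (`exists_mem_inf_conj_eq`) as `V`-conjugates of `V ∩ A` and of `V ∩ g A g⁻¹ ⊇ V ∩ A`.
* (L5) The separation (`IsOfSurfaceType.exists_bObj_trivial_nontrivial`, this seat): some
  `Ã ∈ B(𝒢_X)` is trivial over `(e, Q₂)` and non-trivial over `(e, Q₁)`; with
  `U := Ker(Π_{𝒢_X} ↷ F̃(Ã))` pushed into `Π_𝒢` by the injective `ι` (D1,
  `covering_decompositionGroup_holds`) the kernel dictionary (K1/K2, `BranchActionKernelTransport`)
  gives `V ∩ g A g⁻¹ ⊆ ι(U)` (up to `V`-conjugacy, absorbed since `ι(U) ⊴ V`), hence `V ∩ A ⊆ ι(U)`, hence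
  the `(e, Q₁)`-group lies in `U` — contradicting non-triviality.

Main declarations: `levelEdgeSeparation_aux` (general transport `α`),
`levelEdgeSeparation_of_puncturedSurfaceGroupFiniteIndexSubgroup`,
`remark_2_10_1_of_puncturedSurfaceGroupFiniteIndexSubgroup`, and the unconditional
`levelEdgeSeparation_holds : LevelEdgeSeparation`, `remark_2_10_1_holds : remark_2_10_1`.  No statement
here takes a side on any disputed claim; nothing about [IUTchIII] Cor. 3.12.
-/

namespace Literature.AnabelianGeometry.SemiGraphs

open CategoryTheory CategoryTheory.PreGaloisCategory
open Literature.AnabelianGeometry.Anabelioids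
open scoped Pointwise

universe v₁ u₁ u w

/-! ### Generic helpers -/

section Generic

/-- Conjugating the image of a normal subgroup by an element of the image of the group does nothing.
[folklore] -/
private theorem conjAct_smul_map_eq_of_mem_range {G H : Type*} [Group G] [Group H] (f : G →* H)
    (N : Subgroup G) [N.Normal] {x : H} (hx : x ∈ f.range) :
    ConjAct.toConjAct x • N.map f = N.map f := by
  obtain ⟨t, rfl⟩ := hx
  ext y
  constructor
  · rintro ⟨z, ⟨n, hn, rfl⟩, rfl⟩
    refine ⟨t * n * t⁻¹, Subgroup.Normal.conj_mem inferInstance n hn t, ?_⟩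
    simp [ConjAct.smul_def, map_mul, map_inv]
  · rintro ⟨n, hn, rfl⟩
    refine ⟨f (t⁻¹ * n * t), ⟨t⁻¹ * n * t, ?_, rfl⟩, ?_⟩
    · simpa using Subgroup.Normal.conj_mem inferInstance n hn t⁻¹
    · simp [ConjAct.smul_def, map_mul, map_inv, mul_assoc]

end Generic

namespace SemiGraphOfAnabelioids

variable {𝒢 : SemiGraphOfAnabelioids.{v₁, u₁, u}}

/-! ### Packaging: one dictionary point for all level branches over `b` -/

section Packaging

variable (X : 𝒢.BObj) {v : 𝒢.graph.Vertex} (F : 𝒢.V v ⥤ FintypeCat.{v₁}) [FiberFunctor F]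
  (b : 𝒢.graph.Branch) (h : 𝒢.graph.abuts b = some v)
  (Fe : 𝒢.E (𝒢.graph.edgeOf b) ⥤ FintypeCat.{v₁}) [FiberFunctor Fe]
  (α : (𝒢.pull b v h).pullback ⋙ Fe ≅ F)

set_option backward.isDefEq.respectTransparency false in
/-- The dictionary with the tautological point packaged as an existential: for the covering
`𝒢_X → 𝒢`, a level vertex `ṽ₁ = (v, c₁)` with basepoint `F₁` identified with `F` by `e₁` (whence
`ι : Π_{𝒢_X} → Π_𝒢`), there is ONE point `x_D` of the fibre such that for EVERY level branch `(b, c_Q)`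
over `b` (any basepoints and transports) the image of its group is `Stab(x_D) ∩ γ′ Π_b γ′⁻¹` for some `γ′`
with `(e, c_Q) ∋ y(γ′⁻¹ · x_D)`. [cite: MochizukiSemiAnbd2006, Rem. 2.2.1 p.24] -/
theorem exists_levelBranch_dictionary (c₁ : X.fibreData.FV v)
    (F₁ : X.coveringGraph.V (⟨v, c₁⟩ : X.fibreData.total.Vertex) ⥤ FintypeCat.{v₁}) [FiberFunctor F₁]
    (e₁ : (X.coveringHom.φV (⟨v, c₁⟩ : X.fibreData.total.Vertex)).pullback ⋙ F₁ ≅ F) :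
    ∃ xD : (𝒢.ρ v ⋙ F).obj X,
      ∀ (c₂ : X.fibreData.FV v) (cQ : X.fibreData.FE (𝒢.graph.edgeOf b))
        (hb : X.coveringGraph.graph.abuts (⟨b, cQ⟩ : X.fibreData.total.Branch) =
          some (⟨v, c₂⟩ : X.fibreData.total.Vertex))
        (FP : X.coveringGraph.V (⟨v, c₂⟩ : X.fibreData.total.Vertex) ⥤ FintypeCat.{v₁}) [FiberFunctor FP]
        (FQ : X.coveringGraph.E (X.coveringGraph.graph.edgeOf (⟨b, cQ⟩ : X.fibreData.total.Branch)) ⥤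
          FintypeCat.{v₁}) [FiberFunctor FQ]
        (αQ : (X.coveringGraph.pull (⟨b, cQ⟩ : X.fibreData.total.Branch) ⟨v, c₂⟩ hb).pullback ⋙ FQ ≅ FP)
        (β : X.coveringGraph.ρ (⟨v, c₂⟩ : X.fibreData.total.Vertex) ⋙ FP ≅
          X.coveringGraph.ρ (⟨v, c₁⟩ : X.fibreData.total.Vertex) ⋙ F₁),
        ∃ γ' : 𝒢.Pi v F,
          (((X.coveringGraph.branchSubgroup FP (⟨b, cQ⟩ : X.fibreData.total.Branch) hb FQ αQ).map
                (X.coveringGraph.piVToPi (⟨v, c₂⟩ : X.fibreData.total.Vertex) FP)).map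
              (Aut.autMulEquivOfIso β).toMonoidHom).map
            ((Aut.autMulEquivOfIso (Functor.isoWhiskerLeft (𝒢.ρ v) e₁)).toMonoidHom.comp
              (pi1Map X.coveringHom.pullbackFunctor
                (X.coveringGraph.ρ (⟨v, c₁⟩ : X.fibreData.total.Vertex) ⋙ F₁))) =
            MulAction.stabilizer (𝒢.Pi v F) xD ⊓
              ConjAct.toConjAct γ' • (𝒢.branchSubgroup F b h Fe α).map (𝒢.piVToPi v F) ∧
          Fe.map (X.ψ b v h).hom (α.inv.app (X.S v) (γ'⁻¹ • xD)) ∈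
            Set.range (Fe.map (X.brComp (⟨b, cQ⟩ : X.fibreData.total.Branch)).1.arrow) := by
  obtain ⟨t₁⟩ := X.nonempty_fiber_mkId ⟨v, c₁⟩ F₁
  exact ⟨_, fun c₂ cQ hb FP _ FQ _ αQ β =>
    X.coveringHom_levelBranch_dictionary v c₁ c₂ F₁ F e₁ t₁ b cQ hb FP FQ αQ β h Fe α⟩

end Packaging

/-! ### The assembly -/

/-- **Level-wise edge separation, general transport.**  For `𝒢` of surface type and connected, a
branch `b ∈ e` at `v`, basepoints `F` of `𝒢_v` and `F_e` of `𝒢_e` with transport `α`,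
`A := Im(Π_b → Π_𝒢)` (basepoint `ρ_v ⋙ F`), an open normal `V ⊆ Π_𝒢` and `g ∈ Π_𝒢` with
`V ∩ A ⊆ g A g⁻¹`: `g ∈ V · A`.  Proof: in the Galois covering `𝒢_X → 𝒢` (`X = A_V`, all stabilisers
`V`) the level edges through `y(x_D)` and `y(g⁻¹ · x_D)` are distinct when `g ∉ V · A`; a finite étale
covering of `𝒢_X` trivial over the second and non-trivial over the first (`SurfaceTypeEdgeSeparation`,
surface type of `𝒢_X` granted `PuncturedSurfaceGroupFiniteIndexSubgroup`) contradicts, through the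
kernel of `Π_{𝒢_X}` acting on its fibre (K1/K2) and the dictionary (D1)/(L4b), the inclusion
`V ∩ A ⊆ g A g⁻¹`. [cite: MochizukiSemiAnbd2006, Rem. 2.10.1 p.32] -/
theorem levelEdgeSeparation_aux
    (hGT : Literature.GroupTheory.CombinatorialGroupTheory.PuncturedSurfaceGroupFiniteIndexSubgroup)
    {Sigma : Set ℕ} (hS : 𝒢.IsOfSurfaceType Sigma) (hc : 𝒢.IsConnected) {v : 𝒢.graph.Vertex}
    (F : 𝒢.V v ⥤ FintypeCat.{v₁}) [FiberFunctor F] (b : 𝒢.graph.Branch)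
    (h : 𝒢.graph.abuts b = some v) (Fe : 𝒢.E (𝒢.graph.edgeOf b) ⥤ FintypeCat.{v₁}) [FiberFunctor Fe]
    (α : (𝒢.pull b v h).pullback ⋙ Fe ≅ F) (V : Subgroup (𝒢.Pi v F))
    (hVo : IsOpen (V : Set (𝒢.Pi v F))) [V.Normal] (g : 𝒢.Pi v F)
    (hyp : V ⊓ (𝒢.branchSubgroup F b h Fe α).map (𝒢.piVToPi v F) ≤
      ConjAct.toConjAct g • (𝒢.branchSubgroup F b h Fe α).map (𝒢.piVToPi v F)) :
    g ∈ (V : Set (𝒢.Pi v F)) *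
      ((𝒢.branchSubgroup F b h Fe α).map (𝒢.piVToPi v F) : Set (𝒢.Pi v F)) := by
  classical
  letI := 𝒢.galoisCategory_bObj hc
  haveI : FiberFunctor (𝒢.ρ v ⋙ F) := 𝒢.fiberFunctor_ρ hc v F
  by_contra hg
  -- (L1) the Galois object `X = A_V`: all stabilisers `V`, `[Π_𝒢 : V]` points, hence connected
  obtain ⟨X, hstab, hcard⟩ := exists_bObj_stabilizer_eq F V hVo
  haveI : Finite (𝒢.Pi v F ⧸ V) := Subgroup.quotient_finite_of_isOpen V hVo
  haveI : V.FiniteIndex := Subgroup.finiteIndex_of_finite_quotient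
  haveI : PreGaloisCategory.IsConnected X :=
    isConnected_of_stabilizer_eq_of_card (𝒢.ρ v ⋙ F) X V hstab hcard
  obtain ⟨x₀⟩ := nonempty_fiber_of_isConnected (𝒢.ρ v ⋙ F) X
  -- (L2)/(L3) the level graph `𝒢_X`, connected and of surface type
  have hconn' : X.coveringGraph.IsConnected :=
    covering_isConnected_holds 𝒢 X.coveringGraph X.coveringHom X hc
      (BObj.coveringHom_isFiniteEtaleCoveringOf X) inferInstance
  have hS' : X.coveringGraph.IsOfSurfaceType Sigma :=
    IsOfSurfaceType.of_isFiniteEtaleCoveringGlobal hGT hS X.coveringHom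
      (BObj.coveringHom_isFiniteEtaleCoveringGlobal X)
  letI := X.coveringGraph.galoisCategory_bObj hconn'
  -- the global basepoint of `B(𝒢_X)`: the level vertex `ṽ₁ = (v, P₁)` through `x₀`, `F̃₁`, `e₁`
  obtain ⟨P₁, -⟩ := exists_vComp_mem X F x₀
  -- (the basepoint `F`, as an instance over the vertex `φ(ṽ₁)` — definitionally `v`)
  haveI : @FiberFunctor (𝒢.V (X.coveringHom.base.vertexMap ⟨v, equivShrink _ P₁⟩))
      (𝒢.catV _) (𝒢.galV _).toPreGaloisCategory F := ‹FiberFunctor F›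
  let F₁ := GaloisCategory.getFiberFunctor (X.coveringGraph.V ⟨v, equivShrink _ P₁⟩)
  haveI : FiberFunctor ((X.coveringHom.φV ⟨v, equivShrink _ P₁⟩).pullback ⋙ F₁) :=
    fiberFunctor_comp_of_exact _ _
  obtain ⟨e₁⟩ := nonempty_iso_of_fiberFunctor
    ((X.coveringHom.φV ⟨v, equivShrink _ P₁⟩).pullback ⋙ F₁) F
  haveI : FiberFunctor (X.coveringGraph.ρ ⟨v, equivShrink _ P₁⟩ ⋙ F₁) :=
    X.coveringGraph.fiberFunctor_ρ hconn' _ F₁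
  -- (D1): `ι` is injective with range `V` (the stabiliser of a point of the fibre of `X`)
  have hglob : X.coveringHom.IsGlobalCoveringOf X := by
    rw [← BObj.coveringHomCan_eq_coveringHom]
    exact BObj.coveringHomCan_isGlobalCoveringOf X
  obtain ⟨x₁, hinj, hrange₁⟩ := covering_decompositionGroup_holds 𝒢 X.coveringGraph X.coveringHom X hc
    hconn' (BObj.coveringHom_isFiniteEtaleCoveringOf X) hglob ⟨v, equivShrink _ P₁⟩ F₁ F e₁
  -- (L4b) the dictionary point `x_D` and the branch clause
  obtain ⟨xD, hdict⟩ := exists_levelBranch_dictionary X F b h Fe α (equivShrink _ P₁) F₁ e₁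
  -- the level edges through `y(x_D)` and `y(g⁻¹ • x_D)`: distinct since `g ∉ V·A` (C4)
  obtain ⟨Q₁, hQ₁⟩ := exists_eComp_mem X F b h Fe α xD
  obtain ⟨Q₂, hQ₂⟩ := exists_eComp_mem X F b h Fe α (g⁻¹ • xD)
  have hne : Q₂ ≠ Q₁ := fun hQ =>
    hg ((eComp_eq_iff_mem_mul_of_inv X F b h Fe α hstab g hQ₁ hQ₂).mp hQ)
  have hne' : X.coveringGraph.graph.edgeOf (⟨b, equivShrink _ Q₁⟩ : X.coveringGraph.graph.Branch) ≠
      X.coveringGraph.graph.edgeOf (⟨b, equivShrink _ Q₂⟩ : X.coveringGraph.graph.Branch) :=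
    fun heq => hne ((coveringGraph_edge_mk_eq_iff X Q₁ Q₂).mp heq).symm
  -- basepoints of the level constituents at the two level branches
  let E₁ : X.coveringGraph.E (X.coveringGraph.graph.edgeOf ⟨b, equivShrink _ Q₁⟩) ⥤ FintypeCat.{v₁} :=
    GaloisCategory.getFiberFunctor _
  haveI : FiberFunctor E₁ := inferInstanceAs (FiberFunctor (GaloisCategory.getFiberFunctor _))
  let E₂ : X.coveringGraph.E (X.coveringGraph.graph.edgeOf ⟨b, equivShrink _ Q₂⟩) ⥤ FintypeCat.{v₁} :=
    GaloisCategory.getFiberFunctor _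
  haveI : FiberFunctor E₂ := inferInstanceAs (FiberFunctor (GaloisCategory.getFiberFunctor _))
  let FP₁ : X.coveringGraph.V ⟨v, equivShrink _ (X.componentOver b v h Q₁)⟩ ⥤ FintypeCat.{v₁} :=
    GaloisCategory.getFiberFunctor _
  haveI : FiberFunctor FP₁ := inferInstanceAs (FiberFunctor (GaloisCategory.getFiberFunctor _))
  let FP₂ : X.coveringGraph.V ⟨v, equivShrink _ (X.componentOver b v h Q₂)⟩ ⥤ FintypeCat.{v₁} :=
    GaloisCategory.getFiberFunctor _
  haveI : FiberFunctor FP₂ := inferInstanceAs (FiberFunctor (GaloisCategory.getFiberFunctor _))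
  -- the separating finite étale covering of `𝒢_X`: trivial over `(e, Q₂)`, not over `(e, Q₁)`
  obtain ⟨A', htriv, σ, y, hσy⟩ := hS'.exists_bObj_trivial_nontrivial
    ⟨b, equivShrink _ Q₁⟩ ⟨v, equivShrink _ (X.componentOver b v h Q₁)⟩ (coveringGraph_abuts_mk X b h Q₁)
    ⟨b, equivShrink _ Q₂⟩ ⟨v, equivShrink _ (X.componentOver b v h Q₂)⟩ (coveringGraph_abuts_mk X b h Q₂)
    hne' (coveringGraph_hloop X F b h Fe α hstab hQ₂ hQ₁) E₁ E₂
  -- branch transports `α̃ᵢ` and vertex transports `βᵢ` (to `ṽ₁`) at the two level branches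
  haveI : FiberFunctor ((X.coveringGraph.pull ⟨b, equivShrink _ Q₁⟩
      ⟨v, equivShrink _ (X.componentOver b v h Q₁)⟩ (coveringGraph_abuts_mk X b h Q₁)).pullback ⋙ E₁) :=
    fiberFunctor_comp_of_exact _ _
  haveI : FiberFunctor ((X.coveringGraph.pull ⟨b, equivShrink _ Q₂⟩
      ⟨v, equivShrink _ (X.componentOver b v h Q₂)⟩ (coveringGraph_abuts_mk X b h Q₂)).pullback ⋙ E₂) :=
    fiberFunctor_comp_of_exact _ _
  obtain ⟨α₁⟩ := nonempty_iso_of_fiberFunctor ((X.coveringGraph.pull ⟨b, equivShrink _ Q₁⟩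
      ⟨v, equivShrink _ (X.componentOver b v h Q₁)⟩ (coveringGraph_abuts_mk X b h Q₁)).pullback ⋙ E₁) FP₁
  obtain ⟨α₂⟩ := nonempty_iso_of_fiberFunctor ((X.coveringGraph.pull ⟨b, equivShrink _ Q₂⟩
      ⟨v, equivShrink _ (X.componentOver b v h Q₂)⟩ (coveringGraph_abuts_mk X b h Q₂)).pullback ⋙ E₂) FP₂
  haveI : FiberFunctor (X.coveringGraph.ρ ⟨v, equivShrink _ (X.componentOver b v h Q₁)⟩ ⋙ FP₁) :=
    X.coveringGraph.fiberFunctor_ρ hconn' _ FP₁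
  haveI : FiberFunctor (X.coveringGraph.ρ ⟨v, equivShrink _ (X.componentOver b v h Q₂)⟩ ⋙ FP₂) :=
    X.coveringGraph.fiberFunctor_ρ hconn' _ FP₂
  obtain ⟨β₁⟩ := nonempty_iso_of_fiberFunctor'
    (X.coveringGraph.ρ ⟨v, equivShrink _ (X.componentOver b v h Q₁)⟩ ⋙ FP₁)
    (X.coveringGraph.ρ ⟨v, equivShrink _ P₁⟩ ⋙ F₁)
  obtain ⟨β₂⟩ := nonempty_iso_of_fiberFunctor'
    (X.coveringGraph.ρ ⟨v, equivShrink _ (X.componentOver b v h Q₂)⟩ ⋙ FP₂)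
    (X.coveringGraph.ρ ⟨v, equivShrink _ P₁⟩ ⋙ F₁)
  -- (K1) at the trivial side, (K2) at the non-trivial side
  have hK1 := map_map_branchSubgroup_le_ker_of_edge_trivial A' FP₂ ⟨b, equivShrink _ Q₂⟩
    (coveringGraph_abuts_mk X b h Q₂) E₂ α₂ F₁ β₂ htriv
  have hK2 := not_map_map_branchSubgroup_le_ker_of_edge_nontrivial A' FP₁ ⟨b, equivShrink _ Q₁⟩
    (coveringGraph_abuts_mk X b h Q₁) E₁ α₁ F₁ β₁ ⟨σ, y, hσy⟩
  -- (L4b) the dictionary at the two level branches, repackaged into `V`-classes (C3)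
  obtain ⟨γ₂, hT₂, hγ₂⟩ := hdict (equivShrink _ (X.componentOver b v h Q₂)) (equivShrink _ Q₂)
    (coveringGraph_abuts_mk X b h Q₂) FP₂ E₂ α₂ β₂
  obtain ⟨γ₁, hT₁, hγ₁⟩ := hdict (equivShrink _ (X.componentOver b v h Q₁)) (equivShrink _ Q₁)
    (coveringGraph_abuts_mk X b h Q₁) FP₁ E₁ α₁ β₁
  have hbr₂ : X.brComp (⟨b, equivShrink _ Q₂⟩ : X.fibreData.total.Branch) = Q₂ :=
    Equiv.symm_apply_apply _ _
  have hbr₁ : X.brComp (⟨b, equivShrink _ Q₁⟩ : X.fibreData.total.Branch) = Q₁ :=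
    Equiv.symm_apply_apply _ _
  rw [hbr₂] at hγ₂
  rw [hbr₁] at hγ₁
  rw [hstab xD] at hT₂ hT₁
  obtain ⟨s₂, hs₂V, hs₂⟩ := exists_mem_inf_conj_eq X F b h Fe α hstab γ₂ g hγ₂ hQ₂
  have hQ₁' : Fe.map (X.ψ b v h).hom (α.inv.app (X.S v) ((1 : 𝒢.Pi v F)⁻¹ • xD)) ∈
      Set.range (Fe.map Q₁.1.arrow) := by
    rwa [inv_one, one_smul]
  obtain ⟨s₁, hs₁V, hs₁⟩ := exists_mem_inf_conj_eq X F b h Fe α hstab γ₁ 1 hγ₁ hQ₁'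
  rw [map_one, one_smul] at hs₁
  -- closing algebra inside `Π_𝒢`
  set Pb := (𝒢.branchSubgroup F b h Fe α).map (𝒢.piVToPi v F) with hPb
  set ι := (Aut.autMulEquivOfIso (Functor.isoWhiskerLeft (𝒢.ρ v) e₁)).toMonoidHom.comp
    (pi1Map X.coveringHom.pullbackFunctor (X.coveringGraph.ρ ⟨v, equivShrink _ P₁⟩ ⋙ F₁)) with hι
  set Kr := (MulAction.toPermHom (X.coveringGraph.Pi ⟨v, equivShrink _ P₁⟩ F₁)
    ((X.coveringGraph.ρ ⟨v, equivShrink _ P₁⟩ ⋙ F₁).obj A')).ker with hKr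
  have hinj' : Function.Injective ι := hinj
  have hrange : ι.range = V := hrange₁.trans (hstab x₁)
  have hU : ∀ s ∈ V, ConjAct.toConjAct s • Kr.map ι = Kr.map ι := fun s hs =>
    conjAct_smul_map_eq_of_mem_range ι Kr (hrange.symm ▸ hs)
  -- from (K1): `V ⊓ g • Pb ≤ U := ι(Ker)`
  have h2 : V ⊓ ConjAct.toConjAct g • Pb ≤ Kr.map ι := by
    have h2' : ConjAct.toConjAct s₂ • (V ⊓ ConjAct.toConjAct g • Pb) ≤ Kr.map ι := by
      rw [← hs₂, ← hT₂]
      exact Subgroup.map_mono hK1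
    calc V ⊓ ConjAct.toConjAct g • Pb
        = (ConjAct.toConjAct s₂)⁻¹ • (ConjAct.toConjAct s₂ • (V ⊓ ConjAct.toConjAct g • Pb)) :=
          (inv_smul_smul _ _).symm
      _ ≤ (ConjAct.toConjAct s₂)⁻¹ • Kr.map ι := Subgroup.pointwise_smul_le_pointwise_smul_iff.mpr h2'
      _ = Kr.map ι := by rw [← map_inv]; exact hU _ (V.inv_mem hs₂V)
  -- the hypothesis: `V ⊓ Pb ≤ V ⊓ g • Pb ≤ U`
  have h1 : V ⊓ Pb ≤ Kr.map ι := le_trans (le_inf inf_le_left hyp) h2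
  -- hence the non-trivial side's group lies in the kernel — contradiction with (K2)
  refine hK2 ((Subgroup.map_le_map_iff_of_injective hinj').mp ?_)
  rw [hT₁, hs₁]
  calc ConjAct.toConjAct s₁ • (V ⊓ Pb) ≤ ConjAct.toConjAct s₁ • Kr.map ι :=
        Subgroup.pointwise_smul_le_pointwise_smul_iff.mpr h1
    _ = Kr.map ι := hU s₁ hs₁V

/-- **Level-wise edge separation** ([SemiAnbd] Rmk. 2.10.1, the level-wise content), in the frame
of `LevelEdgeSeparation` (basepoint of `𝒢_v` induced from `F_e` along `b`), granted the classical fact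
`PuncturedSurfaceGroupFiniteIndexSubgroup` (Hoare–Karrass–Solitar; PROVED in the tree as
`puncturedSurfaceGroupFiniteIndexSubgroup_holds` — the unconditional corollary is `levelEdgeSeparation_holds`
below). [cite: MochizukiSemiAnbd2006, Rem. 2.10.1 p.32] -/
theorem levelEdgeSeparation_of_puncturedSurfaceGroupFiniteIndexSubgroup
    (hGT : Literature.GroupTheory.CombinatorialGroupTheory.PuncturedSurfaceGroupFiniteIndexSubgroup) :
    LevelEdgeSeparation.{v₁, u₁, u} := by
  intro 𝒢 Sigma hS hc b v h Fe _ V hVo hVn g hyp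
  haveI : FiberFunctor ((𝒢.pull b v h).pullback ⋙ Fe) := fiberFunctor_comp_of_exact _ Fe
  have key := levelEdgeSeparation_aux hGT hS hc ((𝒢.pull b v h).pullback ⋙ Fe) b h Fe (Iso.refl _)
    V hVo g
  rw [map_piVToPi_branchSubgroup_refl] at key
  exact key hyp

/-- **[SemiAnbd] Remark 2.10.1** (`Π_b ⊆ Π_𝒢` commensurably terminal for `𝒢` of surface type),
granted `PuncturedSurfaceGroupFiniteIndexSubgroup`; unconditional form: `remark_2_10_1_holds` below.
[cite: MochizukiSemiAnbd2006, Rem. 2.10.1 p.32] -/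
theorem remark_2_10_1_of_puncturedSurfaceGroupFiniteIndexSubgroup
    (hGT : Literature.GroupTheory.CombinatorialGroupTheory.PuncturedSurfaceGroupFiniteIndexSubgroup) :
    remark_2_10_1.{v₁, u₁, u} :=
  remark_2_10_1_of_levelEdgeSeparation (levelEdgeSeparation_of_puncturedSurfaceGroupFiniteIndexSubgroup hGT)

/-- **Level-wise edge separation, unconditionally** — the named fact `LevelEdgeSeparation`
(`Remark2101Reduction.lean`) DISCHARGED: `levelEdgeSeparation_of_puncturedSurfaceGroupFiniteIndexSubgroup`
fed with the tree's proof `puncturedSurfaceGroupFiniteIndexSubgroup_holds` of the classical fact on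
finite-index subgroups of punctured surface groups (Hoare–Karrass–Solitar).
[cite: MochizukiSemiAnbd2006, Rem. 2.10.1 p.32] -/
theorem levelEdgeSeparation_holds : LevelEdgeSeparation.{v₁, u₁, u} :=
  levelEdgeSeparation_of_puncturedSurfaceGroupFiniteIndexSubgroup
    Literature.GroupTheory.CombinatorialGroupTheory.puncturedSurfaceGroupFiniteIndexSubgroup_holds

/-- **[SemiAnbd] Remark 2.10.1, unconditionally**: for a connected semi-graph of anabelioids of surface
type, every edge group `Π_b ⊆ Π_𝒢` is commensurably terminal (`C_{Π_𝒢}(Π_b) = Π_b`).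
[cite: MochizukiSemiAnbd2006, Rem. 2.10.1 p.32] -/
theorem remark_2_10_1_holds : remark_2_10_1.{v₁, u₁, u} :=
  remark_2_10_1_of_levelEdgeSeparation levelEdgeSeparation_holds

end SemiGraphOfAnabelioids

end Literature.AnabelianGeometry.SemiGraphs
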